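import Summits.ResolutionOfSingularities.ResolutionOfSingularities.Theorems.FrobeniusLadderFInjectiveMacaulayficationIdealSheafOfClosedCurve
import Literature.AlgebraicGeometry.Dimension.PointDimension
import Literature.AlgebraicGeometry.Resolution.MarkedIdeals
import HarnessLib

/-!
# The ideal sheaf of the closure of a point (`IdealSheafOfPointClosure`, E7 N5b)

[OURS · L1 W4.5a] Support file for crux stmt-ResolutionOfSingularities-15315
(`FrobeniusLadder.FInjectiveMacaulayfication`), E7 two-level tower format, instance layer (res-L1-w45a-lead-1
10:46:50Z «N5b `IdealSheafOfPointClosure`»). For a point `ξ` of a scheme `X` (the generic point of the bad line of a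
two-level tower) let `J₂ := 𝓘(closure {ξ})` be res-type-034's N1 ideal sheaf
(`Scheme.IdealSheafData.vanishingIdeal ⟨closure {ξ}, isClosed_closure⟩`, file `…IdealSheafOfClosedCurve`). Its CHART IDEALS:

* `primeIdealOf_le_iff_mem_closure` — on an affine open `U ∋ ξ`, `𝔭_ξ ≤ 𝔭_x ↔ x ∈ closure {ξ}` (specialisation read in the
  chart, `Literature…Scheme.specializes_iff_primeIdealOf_le`);
* `ideal_eq_primeIdealOf` — `J₂.ideal U = 𝔭_ξ` when `ξ ∈ U` (N1 rev 2 `ideal_vanishingIdeal_eq_of_forall_primeIdealOf_iff`);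
* `ideal_eq_top` — `J₂.ideal U = ⊤` when `ξ ∉ U` (an open set misses `closure {ξ}` iff it misses `ξ`; N1
  `ideal_vanishingIdeal_eq_top_of_disjoint`);
* `mem_ideal_iff` (membership = membership in `𝔭_ξ`), `coe_support` (`supp J₂ = closure {ξ}`), `mem_support` (`ξ ∈ supp J₂`),
  `ne_bot` (`J₂ ≠ ⊥` once `closure {ξ} ≠ X`), and `stalkIdeal_eq_maximalIdeal` (`(J₂)_ξ = 𝔪_ξ`: the centre is the maximal
  ideal at its generic point).

So in `TwoLevelTower.twoLevelTower_good` with `J₂ := 𝓘(closure {ξ})` the binders `hv : v σ j ∈ J₂.ideal (U σ)` read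
`v σ j ∈ 𝔭_ξ` on the charts through `ξ` and are vacuous (`J₂.ideal = ⊤`, cover family `v = (1)`) on the charts missing `ξ`.
References: folklore bookkeeping over Mathlib's `AlgebraicGeometry.IdealSheaf` / `AffineScheme` API; no statement of
Hironaka 2017 is used; no definition, no named fact; AI-written (AI review is weaker than expert review). [folklore]
-/

-- single-problem summit: the doubled namespace component `ResolutionOfSingularities` is forced
set_option linter.dupNamespace false

noncomputable section

namespace Summit.ResolutionOfSingularities.ResolutionOfSingularities.Theorems.FInjectiveMacaulayfication.IdealSheafOfPointClosure

open AlgebraicGeometry CategoryTheory TopologicalSpace IsLocalRing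
open Summit.ResolutionOfSingularities.ResolutionOfSingularities.Theorems.FInjectiveMacaulayfication

universe u

variable {X : Scheme.{u}}

/-- **Specialisation read in an affine chart:** for `ξ, x ∈ U`, `𝔭_ξ ≤ 𝔭_x ↔ x ∈ closure {ξ}`. [folklore] -/
theorem primeIdealOf_le_iff_mem_closure (U : X.affineOpens) (ξ : X) (hξ : ξ ∈ (U : X.Opens)) (x : X)
    (hx : x ∈ (U : X.Opens)) :
    (U.2.primeIdealOf ⟨ξ, hξ⟩).asIdeal ≤ (U.2.primeIdealOf ⟨x, hx⟩).asIdeal ↔ x ∈ closure ({ξ} : Set X) := by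
  rw [← specializes_iff_mem_closure, PrimeSpectrum.asIdeal_le_asIdeal,
    ← Literature.AlgebraicGeometry.Dimension.Scheme.specializes_iff_primeIdealOf_le U.2 ⟨ξ, hξ⟩ ⟨x, hx⟩]

/-- **The chart ideal through `ξ`: `𝓘(closure {ξ}).ideal U = 𝔭_ξ`** for an affine open `U ∋ ξ`. [folklore] -/
theorem ideal_eq_primeIdealOf (ξ : X) (U : X.affineOpens) (hξ : ξ ∈ (U : X.Opens)) :
    (Scheme.IdealSheafData.vanishingIdeal (⟨closure ({ξ} : Set X), isClosed_closure⟩ : Closeds X)).ideal U =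
      (U.2.primeIdealOf ⟨ξ, hξ⟩).asIdeal :=
  IdealSheafOfClosedCurve.ideal_vanishingIdeal_eq_of_forall_primeIdealOf_iff _ U _
    (fun x hx => primeIdealOf_le_iff_mem_closure U ξ hξ x hx)

/-- **Membership in the chart ideal through `ξ`** is membership in `𝔭_ξ`. [folklore] -/
theorem mem_ideal_iff (ξ : X) (U : X.affineOpens) (hξ : ξ ∈ (U : X.Opens)) (f : Γ(X, U)) :
    f ∈ (Scheme.IdealSheafData.vanishingIdeal (⟨closure ({ξ} : Set X), isClosed_closure⟩ : Closeds X)).ideal U ↔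
      f ∈ (U.2.primeIdealOf ⟨ξ, hξ⟩).asIdeal := by
  rw [ideal_eq_primeIdealOf ξ U hξ]

/-- An open set meeting `closure {ξ}` contains `ξ`; contrapositive: an affine open missing `ξ` misses `closure {ξ}`.
[folklore] -/
theorem closure_inter_eq_empty_of_notMem (ξ : X) (U : X.affineOpens) (hξ : ξ ∉ (U : X.Opens)) :
    closure ({ξ} : Set X) ∩ ((U : X.Opens) : Set X) = ∅ := by
  refine Set.eq_empty_iff_forall_notMem.mpr fun x hx => hξ ?_
  obtain ⟨hxcl, hxU⟩ := hx
  obtain ⟨y, hyU, hyξ⟩ := mem_closure_iff.mp hxcl (U : X.Opens) (U : X.Opens).isOpen hxU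
  rw [Set.mem_singleton_iff] at hyξ
  rw [hyξ] at hyU
  exact hyU

/-- **The chart ideal off `ξ`: `𝓘(closure {ξ}).ideal U = ⊤`** for an affine open `U ∌ ξ`. [folklore] -/
theorem ideal_eq_top (ξ : X) (U : X.affineOpens) (hξ : ξ ∉ (U : X.Opens)) :
    (Scheme.IdealSheafData.vanishingIdeal (⟨closure ({ξ} : Set X), isClosed_closure⟩ : Closeds X)).ideal U = ⊤ :=
  IdealSheafOfClosedCurve.ideal_vanishingIdeal_eq_top_of_disjoint _ U (closure_inter_eq_empty_of_notMem ξ U hξ)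

/-- **`supp 𝓘(closure {ξ}) = closure {ξ}`.** [folklore] -/
theorem coe_support (ξ : X) :
    ((Scheme.IdealSheafData.vanishingIdeal (⟨closure ({ξ} : Set X), isClosed_closure⟩ : Closeds X)).support : Set X) =
      closure ({ξ} : Set X) :=
  Scheme.IdealSheafData.coe_support_vanishingIdeal _

/-- **`ξ ∈ supp 𝓘(closure {ξ})`.** [folklore] -/
theorem mem_support (ξ : X) :
    ξ ∈ ((Scheme.IdealSheafData.vanishingIdeal (⟨closure ({ξ} : Set X), isClosed_closure⟩ : Closeds X)).support : Set X) := by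
  rw [coe_support]
  exact subset_closure (Set.mem_singleton ξ)

/-- **`𝓘(closure {ξ}) ≠ ⊥`** as soon as `ξ` is not a generic point of `X` (`closure {ξ} ≠ X`). [folklore] -/
theorem ne_bot (ξ : X) (h : closure ({ξ} : Set X) ≠ Set.univ) :
    Scheme.IdealSheafData.vanishingIdeal (⟨closure ({ξ} : Set X), isClosed_closure⟩ : Closeds X) ≠ ⊥ :=
  IdealSheafOfClosedCurve.vanishingIdeal_ne_bot_of_ne_univ _ h

/-- **The stalk at the generic point is the maximal ideal: `𝓘(closure {ξ})_ξ = 𝔪_ξ`** (the germ map `Γ(X, U) → 𝒪_{X,ξ}` is the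
localization at `𝔭_ξ`, and `𝔭_ξ · 𝒪_{X,ξ} = 𝔪_ξ`). [folklore] -/
theorem stalkIdeal_eq_maximalIdeal (ξ : X) :
    Literature.AlgebraicGeometry.Resolution.stalkIdeal
        (Scheme.IdealSheafData.vanishingIdeal (⟨closure ({ξ} : Set X), isClosed_closure⟩ : Closeds X)) ξ =
      maximalIdeal (X.presheaf.stalk ξ) := by
  obtain ⟨U₀, hU₀, hξU, -⟩ := exists_isAffineOpen_mem_and_subset (X := X) (x := ξ) (U := ⊤) (Opens.mem_top ξ)
  let U : X.affineOpens := ⟨U₀, hU₀⟩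
  letI := TopCat.Presheaf.algebra_section_stalk X.presheaf (⟨ξ, hξU⟩ : (U : X.Opens))
  haveI : IsLocalization.AtPrime (X.presheaf.stalk ξ) (U.2.primeIdealOf ⟨ξ, hξU⟩).asIdeal :=
    U.2.isLocalization_stalk ⟨ξ, hξU⟩
  rw [Literature.AlgebraicGeometry.Resolution.stalkIdeal_eq_map_germ _ U hξU, ideal_eq_primeIdealOf ξ U hξU]
  exact IsLocalization.AtPrime.map_eq_maximalIdeal (U.2.primeIdealOf ⟨ξ, hξU⟩).asIdeal (X.presheaf.stalk ξ)

end Summit.ResolutionOfSingularities.ResolutionOfSingularities.Theorems.FInjectiveMacaulayfication.IdealSheafOfPointClosure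

end
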